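/- Free-seat work of EXTRA WIDTH SEAT `ym-line-cbag-p1-w5` (prover-ym-line-cbag-p1-w5-g3-0), route `EguchiKawaiDirectionLadder`
(ideator ym-idea-2, LINE 8), crux `TripleSmallBallMargin` (stmt-QuantumFields-27724), v7 S10-C glue: the PER-BLOCK PLUG-INS.  The
one-level decoupling capstone asks, for every decoupled block `c` (index subtype `{i // ℓ i = c}` of size `n_c`), for bounds on
(ρ) `Haar_c{V | ∃ R, rank R ≤ r ∧ ‖diag(d|_c)V − V diag(d|_c) − R‖_F² ≤ B}` and (ψ) `Haar_c²{(P₁,P₂) | ∃ L, rank L ≤ r ∧ ‖P₁P₂ − P₂P₁ − L‖_F² ≤ B}`;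
the rank-robust bounds E_rob / Ψ_rob are theorems about `UN n` with phases `Fin n → ℂ` and budget `n·t`.  This file performs the
transport (`…HaarReindex`) and the phase bookkeeping (`…BlockPhases`) once and for all: block-form measure = `Fin n_c`-form measure, and
hence ≤ ANY bound valid on `UN n_c`, at budget `t = B/n_c` and phases `d ∘ ι_c`.  ROUTE-INDEPENDENT bookkeeping.  Nothing here bears
on the Yang–Mills mass gap. -/
import Summits.QuantumFields.YangMills.Theorems.EguchiKawaiDirectionLadderHaarReindex
import Summits.QuantumFields.YangMills.Theorems.EguchiKawaiDirectionLadderBlockPhases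
import HarnessLib

/-!
# Route `EguchiKawaiDirectionLadder`: per-block plug-ins (block subtype → `UN n`)

For a decidable predicate `p` on `Fin N` (a block), an equivalence `e : {i // p i} ≃ Fin n` with `(e.symm a : Fin N) = ι a`
(`BlockPhases.exists_blockEquiv`), phases `d : Fin N → ℂ`:

* `haar_block_rankRobustLink_eq` — the block rigidity-event measure equals the `UN n` rigidity-event measure with phases `d ∘ ι`;
  `haar_block_rankRobustLink_le` — hence it is bounded by any `UN n` bound `Φ q t u` valid for `q ≤ n`, `0 < t ≤ 1/18`, unit phases `u`
  (shape of `haar_rankRobustRigidity_le`), at `q = r`, `t = B/n`, `u = d ∘ ι` (needs `r ≤ n`, `0 < B ≤ n/18`);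
* `haarPair_block_rankRobustComm_eq`, `haarPair_block_rankRobustComm_le` — the same for the Haar-pair rank-robust commutator event
  (shape of `haarPair_rankRobustComm_le`);
* `min_mul_self_le_min` — monotonicity of `min (ρ·ρ) ψ` in both arguments (the `h_p` slot).

HONEST FRAMING: transport bookkeeping only.  The route bears on the barrier-ledger fact `EguchiKawaiBreakdown`; the Yang–Mills mass gap
is NOT touched.
-/

set_option autoImplicit false

noncomputable section

open MeasureTheory
open scoped Matrix ENNReal
open Literature.Barriers.QuantumFields
open Literature.MathematicalPhysics.QuantumFieldTheory (haarProbability)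

namespace Summit.QuantumFields.YangMills.Theorems.EguchiKawaiDirectionLadder

namespace BlockPlug

variable {N : ℕ}

/-! ### §1 The rigidity branch (ρ) -/

/-- **Block rigidity event = `UN n` rigidity event** (phases `d ∘ ι`). -/
theorem haar_block_rankRobustLink_eq (p : Fin N → Prop) [DecidablePred p] {n : ℕ} (e : {i // p i} ≃ Fin n) (ι : Fin n → Fin N)
    (he : ∀ a, ((e.symm a : {i // p i}) : Fin N) = ι a) (d : Fin N → ℂ) (r : ℕ) (B : ℝ) :
    haarProbability (Matrix.unitaryGroup {i // p i} ℂ)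
        {V | ∃ R : Matrix {i // p i} {i // p i} ℂ, R.rank ≤ r ∧
          ∑ i, ∑ j, ‖(Matrix.diagonal (fun i : {i // p i} => d i) * (V : Matrix {i // p i} {i // p i} ℂ) -
            (V : Matrix {i // p i} {i // p i} ℂ) * Matrix.diagonal (fun i : {i // p i} => d i) - R) i j‖ ^ 2 ≤ B} =
      haarProbability (UN n)
        {V | ∃ R : Matrix (Fin n) (Fin n) ℂ, R.rank ≤ r ∧
          ∑ i, ∑ j, ‖(Matrix.diagonal (d ∘ ι) * (V : Matrix (Fin n) (Fin n) ℂ) -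
            (V : Matrix (Fin n) (Fin n) ℂ) * Matrix.diagonal (d ∘ ι) - R) i j‖ ^ 2 ≤ B} := by
  rw [HaarReindex.haarProbability_rankRobustLink_reindex e, BlockPhases.reindex_diagonal_val d e ι he]

/-- **Block rigidity event ≤ any `UN n` bound** (shape of `haar_rankRobustRigidity_le` at a fixed admissible `n`): with `Φ q t u` a
bound for rank slack `q ≤ n`, budget `n·t` (`0 < t ≤ 1/18`) and unit phases `u`, the block event at rank slack `r ≤ n` and budget
`0 < B ≤ n/18` is `≤ Φ r (B/n) (d ∘ ι)`. -/
theorem haar_block_rankRobustLink_le (p : Fin N → Prop) [DecidablePred p] {n : ℕ} (e : {i // p i} ≃ Fin n) (ι : Fin n → Fin N)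
    (he : ∀ a, ((e.symm a : {i // p i}) : Fin N) = ι a) {d : Fin N → ℂ} (hd : ∀ i, ‖d i‖ = 1)
    {Φ : ℕ → ℝ → (Fin n → ℂ) → ℝ≥0∞}
    (hΦ : ∀ q : ℕ, q ≤ n → ∀ t : ℝ, 0 < t → t ≤ 1 / 18 → ∀ u : Fin n → ℂ, (∀ a, ‖u a‖ = 1) →
      haarProbability (UN n)
          {V | ∃ R : Matrix (Fin n) (Fin n) ℂ, R.rank ≤ q ∧
            ∑ i, ∑ j, ‖(Matrix.diagonal u * (V : Matrix (Fin n) (Fin n) ℂ) -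
              (V : Matrix (Fin n) (Fin n) ℂ) * Matrix.diagonal u - R) i j‖ ^ 2 ≤ n * t} ≤ Φ q t u)
    {r : ℕ} (hr : r ≤ n) {B : ℝ} (hB0 : 0 < B) (hB : B ≤ n / 18) :
    haarProbability (Matrix.unitaryGroup {i // p i} ℂ)
        {V | ∃ R : Matrix {i // p i} {i // p i} ℂ, R.rank ≤ r ∧
          ∑ i, ∑ j, ‖(Matrix.diagonal (fun i : {i // p i} => d i) * (V : Matrix {i // p i} {i // p i} ℂ) -
            (V : Matrix {i // p i} {i // p i} ℂ) * Matrix.diagonal (fun i : {i // p i} => d i) - R) i j‖ ^ 2 ≤ B} ≤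
      Φ r (B / n) (d ∘ ι) := by
  rw [haar_block_rankRobustLink_eq p e ι he d r B]
  have hn : (0 : ℝ) < n := by
    by_contra h
    push Not at h
    have : B ≤ 0 := hB.trans (by
      have : (n : ℝ) / 18 ≤ 0 := div_nonpos_of_nonpos_of_nonneg h (by norm_num)
      exact this)
    linarith
  have ht : 0 < B / n := div_pos hB0 hn
  have ht18 : B / n ≤ 1 / 18 := by
    rw [div_le_iff₀ hn]; linarith
  have h := hΦ r hr (B / n) ht ht18 (d ∘ ι) (BlockPhases.norm_comp_eq_one d hd ι)
  rwa [mul_div_cancel₀ B hn.ne'] at h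

/-! ### §2 The commutator branch (ψ) -/

/-- **Block Haar-pair rank-robust commutator event = `UN n` event.** -/
theorem haarPair_block_rankRobustComm_eq (p : Fin N → Prop) [DecidablePred p] {n : ℕ} (e : {i // p i} ≃ Fin n) (r : ℕ) (B : ℝ) :
    (haarProbability (Matrix.unitaryGroup {i // p i} ℂ)).prod (haarProbability (Matrix.unitaryGroup {i // p i} ℂ))
        {P | ∃ L : Matrix {i // p i} {i // p i} ℂ, L.rank ≤ r ∧
          ∑ i, ∑ j, ‖((P.1 : Matrix {i // p i} {i // p i} ℂ) * (P.2 : Matrix {i // p i} {i // p i} ℂ) -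
            (P.2 : Matrix {i // p i} {i // p i} ℂ) * (P.1 : Matrix {i // p i} {i // p i} ℂ) - L) i j‖ ^ 2 ≤ B} =
      (haarProbability (UN n)).prod (haarProbability (UN n))
        {P | ∃ L : Matrix (Fin n) (Fin n) ℂ, L.rank ≤ r ∧
          ∑ i, ∑ j, ‖((P.1 : Matrix (Fin n) (Fin n) ℂ) * (P.2 : Matrix (Fin n) (Fin n) ℂ) -
            (P.2 : Matrix (Fin n) (Fin n) ℂ) * (P.1 : Matrix (Fin n) (Fin n) ℂ) - L) i j‖ ^ 2 ≤ B} :=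
  HaarReindex.haarPair_rankRobustCommutator_reindex e r B

/-- **Block Haar-pair event ≤ any `UN n` bound** (shape of `haarPair_rankRobustComm_le` at a fixed admissible `n`): with `Ψ k t` a bound
for rank slack `k ≤ n` and budget `n·t` (`0 < t ≤ 1/18`), the block event at rank slack `r ≤ n` and budget `0 < B ≤ n/18` is
`≤ Ψ r (B/n)`. -/
theorem haarPair_block_rankRobustComm_le (p : Fin N → Prop) [DecidablePred p] {n : ℕ} (e : {i // p i} ≃ Fin n)
    {Ψ : ℕ → ℝ → ℝ≥0∞}
    (hΨ : ∀ k : ℕ, k ≤ n → ∀ t : ℝ, 0 < t → t ≤ 1 / 18 →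
      (haarProbability (UN n)).prod (haarProbability (UN n))
          {P | ∃ L : Matrix (Fin n) (Fin n) ℂ, L.rank ≤ k ∧
            ∑ i, ∑ j, ‖((P.1 : Matrix (Fin n) (Fin n) ℂ) * (P.2 : Matrix (Fin n) (Fin n) ℂ) -
              (P.2 : Matrix (Fin n) (Fin n) ℂ) * (P.1 : Matrix (Fin n) (Fin n) ℂ) - L) i j‖ ^ 2 ≤ n * t} ≤ Ψ k t)
    {r : ℕ} (hr : r ≤ n) {B : ℝ} (hB0 : 0 < B) (hB : B ≤ n / 18) :
    (haarProbability (Matrix.unitaryGroup {i // p i} ℂ)).prod (haarProbability (Matrix.unitaryGroup {i // p i} ℂ))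
        {P | ∃ L : Matrix {i // p i} {i // p i} ℂ, L.rank ≤ r ∧
          ∑ i, ∑ j, ‖((P.1 : Matrix {i // p i} {i // p i} ℂ) * (P.2 : Matrix {i // p i} {i // p i} ℂ) -
            (P.2 : Matrix {i // p i} {i // p i} ℂ) * (P.1 : Matrix {i // p i} {i // p i} ℂ) - L) i j‖ ^ 2 ≤ B} ≤
      Ψ r (B / n) := by
  rw [haarPair_block_rankRobustComm_eq p e r B]
  have hn : (0 : ℝ) < n := by
    by_contra h
    push Not at h
    have : (n : ℝ) / 18 ≤ 0 := div_nonpos_of_nonpos_of_nonneg h (by norm_num)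
    linarith
  have ht : 0 < B / n := div_pos hB0 hn
  have ht18 : B / n ≤ 1 / 18 := by
    rw [div_le_iff₀ hn]; linarith
  have h := hΨ r hr (B / n) ht ht18
  rwa [mul_div_cancel₀ B hn.ne'] at h

/-! ### §3 The `h_p` slot -/

/-- Monotonicity of `min (ρ·ρ) ψ`: bounds `ρ ≤ ρ'`, `ψ ≤ ψ'` give `min (ρ·ρ) ψ ≤ min (ρ'·ρ') ψ'`. -/
theorem min_mul_self_le_min {ρ ρ' ψ ψ' : ℝ≥0∞} (hρ : ρ ≤ ρ') (hψ : ψ ≤ ψ') : min (ρ * ρ) ψ ≤ min (ρ' * ρ') ψ' :=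
  min_le_min (mul_le_mul' hρ hρ) hψ

/-- Budget monotonicity of the block rigidity event: enlarging `B` and the rank slack enlarges the event. -/
theorem haar_block_rankRobustLink_mono (p : Fin N → Prop) [DecidablePred p] (d : Fin N → ℂ) {r r' : ℕ} (hrr : r ≤ r')
    {B B' : ℝ} (hBB : B ≤ B') :
    haarProbability (Matrix.unitaryGroup {i // p i} ℂ)
        {V | ∃ R : Matrix {i // p i} {i // p i} ℂ, R.rank ≤ r ∧
          ∑ i, ∑ j, ‖(Matrix.diagonal (fun i : {i // p i} => d i) * (V : Matrix {i // p i} {i // p i} ℂ) -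
            (V : Matrix {i // p i} {i // p i} ℂ) * Matrix.diagonal (fun i : {i // p i} => d i) - R) i j‖ ^ 2 ≤ B} ≤
      haarProbability (Matrix.unitaryGroup {i // p i} ℂ)
        {V | ∃ R : Matrix {i // p i} {i // p i} ℂ, R.rank ≤ r' ∧
          ∑ i, ∑ j, ‖(Matrix.diagonal (fun i : {i // p i} => d i) * (V : Matrix {i // p i} {i // p i} ℂ) -
            (V : Matrix {i // p i} {i // p i} ℂ) * Matrix.diagonal (fun i : {i // p i} => d i) - R) i j‖ ^ 2 ≤ B'} :=
  measure_mono fun _ ⟨R, hR, hV⟩ => ⟨R, hR.trans hrr, hV.trans hBB⟩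

/-- Budget monotonicity of the block Haar-pair event. -/
theorem haarPair_block_rankRobustComm_mono (p : Fin N → Prop) [DecidablePred p] {r r' : ℕ} (hrr : r ≤ r')
    {B B' : ℝ} (hBB : B ≤ B') :
    (haarProbability (Matrix.unitaryGroup {i // p i} ℂ)).prod (haarProbability (Matrix.unitaryGroup {i // p i} ℂ))
        {P | ∃ L : Matrix {i // p i} {i // p i} ℂ, L.rank ≤ r ∧
          ∑ i, ∑ j, ‖((P.1 : Matrix {i // p i} {i // p i} ℂ) * (P.2 : Matrix {i // p i} {i // p i} ℂ) -
            (P.2 : Matrix {i // p i} {i // p i} ℂ) * (P.1 : Matrix {i // p i} {i // p i} ℂ) - L) i j‖ ^ 2 ≤ B} ≤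
      (haarProbability (Matrix.unitaryGroup {i // p i} ℂ)).prod (haarProbability (Matrix.unitaryGroup {i // p i} ℂ))
        {P | ∃ L : Matrix {i // p i} {i // p i} ℂ, L.rank ≤ r' ∧
          ∑ i, ∑ j, ‖((P.1 : Matrix {i // p i} {i // p i} ℂ) * (P.2 : Matrix {i // p i} {i // p i} ℂ) -
            (P.2 : Matrix {i // p i} {i // p i} ℂ) * (P.1 : Matrix {i // p i} {i // p i} ℂ) - L) i j‖ ^ 2 ≤ B'} :=
  measure_mono fun _ ⟨L, hL, hP⟩ => ⟨L, hL.trans hrr, hP.trans hBB⟩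

end BlockPlug

end Summit.QuantumFields.YangMills.Theorems.EguchiKawaiDirectionLadder

end
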